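import Literature.Analysis.FluidPDE.TypeIAncientMild
import Literature.Analysis.FluidPDE.HyperbolicDSSOrbit
import Literature.Analysis.FluidPDE.LerayGaugeStrainSpectrum
import Mathlib.MeasureTheory.Measure.Lebesgue.VolumeOfBalls
import Mathlib.MeasureTheory.Measure.OpenPos
import Mathlib.Analysis.Calculus.MeanValue
import HarnessLib

/-!
# Crux `MustSqueeze` (stmt-NavierStokesRegularity-11610), line `outward-drift-signed-flux`:
# the endgame `stub_endgame`

In backward similarity variables `U = lerayOrbit u` (`U(s, y) = e^{-s/2} u(-e^{-s}, e^{-s/2} y)`)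
the two Grönwall passes of the line kill every ball gradient energy
`E(ρ, s) = ∫_{B_ρ(0)} |∇U(s)|²_F`.  The endgame turns `E ≡ 0` into `u ≡ 0` on the past:

1. each slice `U(s, ·)` is `C¹` (the class is jointly smooth on `t < 0`, and the similarity map is
   smooth), so the Frobenius density `y ↦ |∇U(s, y)|²_F` is continuous and nonnegative;
2. a continuous nonnegative function with zero integral over every ball `B_ρ(0)` vanishes
   identically (a.e. zero on the open ball `B_{‖y₀‖+1}(0) ∋ y₀`, hence zero there by continuity),
   so `∇U(s) ≡ 0` (`frobeniusNormSq_eq_zero_iff`);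
3. a `C¹` map with vanishing derivative is constant: `U(s, y) = U(s, 0) =: c`;
4. the Morrey bound `∫_{B_ρ(0)} ‖U(s)‖² ≤ C ρ` reads `(4π/3) ρ³ ‖c‖² ≤ C ρ` for every `ρ > 0`,
   which forces `c = 0`;
5. `u(t, x) = (√(-t))⁻¹ U(-log(-t), x/√(-t)) = 0` for `t < 0` (`eq_lerayOrbit_of_neg`).
-/

noncomputable section

open MeasureTheory Set Metric Filter

namespace Summit.NavierStokesRegularity.NavierStokesRegularity.Theorems

open Literature.Analysis.FluidPDE

/-- Physical / similarity space `ℝ³`. -/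
local notation "ℝ³" => EuclideanSpace ℝ (Fin 3)

-- adapted from Cruxes/MustSqueeze/NegativeNotes-StubGradEnergyBasicAndBits.lean
-- (`Drefute.contDiff_lerayOrbit_slice`)
/-- Slices `U(s, ·)` of the similarity orbit of a class element are `C^n` (composition of the
jointly smooth `uncurry (lerayOrbit u)` with `y ↦ (s, y)`). [folklore] -/
theorem mustSqueeze_contDiff_lerayOrbit_slice {C : ℝ} {u : ℝ → ℝ³ → ℝ³}
    (hu : IsTypeIAncientMild C u) (s : ℝ) {n : ℕ∞} : ContDiff ℝ n (lerayOrbit u s) := by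
  have h : ContDiff ℝ n (Function.uncurry (lerayOrbit u)) :=
    contDiff_uncurry_lerayOrbit (hu.contDiffOn.of_le (by exact_mod_cast le_top))
  exact h.comp (contDiff_prodMk_right s)

-- adapted from Cruxes/MustSqueeze/NegativeNotes-StubGradEnergyBasicAndBits.lean
-- (`Drefute.continuous_frobeniusNormSq_fderiv_lerayOrbit`)
/-- The Frobenius gradient density `y ↦ |∇U(s, y)|²_F` of a slice of the orbit is
continuous. [folklore] -/
theorem mustSqueeze_continuous_frobeniusNormSq_fderiv_lerayOrbit {C : ℝ} {u : ℝ → ℝ³ → ℝ³}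
    (hu : IsTypeIAncientMild C u) (s : ℝ) :
    Continuous fun y => frobeniusNormSq (fderiv ℝ (lerayOrbit u s) y) := by
  have hc : Continuous (fderiv ℝ (lerayOrbit u s)) :=
    (mustSqueeze_contDiff_lerayOrbit_slice hu s (n := 1)).continuous_fderiv one_ne_zero
  unfold frobeniusNormSq
  exact continuous_finsetSum _ fun i _ => ((hc.clm_apply continuous_const).norm).pow 2

/-- **Vanishing ball gradient energies force a vanishing gradient**: if
`∫_{B_ρ(0)} |∇U(s)|²_F = 0` for every `ρ > 0` then `∇U(s) ≡ 0` (the density is continuous and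
nonnegative, so it is a.e. zero, hence zero, on the open ball `B_{‖y₀‖+1}(0) ∋ y₀`). [folklore] -/
theorem mustSqueeze_fderiv_lerayOrbit_eq_zero {C : ℝ} {u : ℝ → ℝ³ → ℝ³}
    (hu : IsTypeIAncientMild C u) {s : ℝ}
    (hE : ∀ ρ : ℝ, 0 < ρ →
      ∫ y in Metric.ball (0 : ℝ³) ρ, frobeniusNormSq (fderiv ℝ (lerayOrbit u s) y) = 0)
    (y₀ : ℝ³) : fderiv ℝ (lerayOrbit u s) y₀ = 0 := by
  have hcont := mustSqueeze_continuous_frobeniusNormSq_fderiv_lerayOrbit hu s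
  have hρ : 0 < ‖y₀‖ + 1 := by positivity
  have hint : IntegrableOn (fun y => frobeniusNormSq (fderiv ℝ (lerayOrbit u s) y))
      (ball (0 : ℝ³) (‖y₀‖ + 1)) volume :=
    (hcont.continuousOn.integrableOn_compact (isCompact_closedBall _ _)).mono_set
      ball_subset_closedBall
  have hae := (setIntegral_eq_zero_iff_of_nonneg_ae
    (Eventually.of_forall fun y => frobeniusNormSq_nonneg _) hint).1 (hE _ hρ)
  have heq := Measure.eqOn_open_of_ae_eq hae isOpen_ball hcont.continuousOn continuousOn_const
  have hy₀ : y₀ ∈ ball (0 : ℝ³) (‖y₀‖ + 1) := mem_ball_zero_iff.2 (lt_add_one _)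
  exact (frobeniusNormSq_eq_zero_iff _).1 (heq hy₀)

/-- The volume of a ball of `ℝ³`: `|B_ρ(y₀)| = (4π/3) ρ³` for `ρ ≥ 0`. [folklore] -/
theorem mustSqueeze_volume_real_ball (y₀ : ℝ³) {ρ : ℝ} (hρ : 0 ≤ ρ) :
    (volume : Measure ℝ³).real (ball y₀ ρ) = ρ ^ 3 * (Real.pi * 4 / 3) := by
  rw [measureReal_def, EuclideanSpace.volume_ball_fin_three, ENNReal.toReal_mul,
    ENNReal.toReal_pow, ENNReal.toReal_ofReal hρ, ENNReal.toReal_ofReal (by positivity)]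

/-- **A constant slice with linear Morrey growth vanishes**: if `U(s, ·) ≡ c` and
`∫_{B_ρ(0)} ‖U(s)‖² ≤ C ρ` for all `ρ > 0`, then `(4π/3) ρ³ ‖c‖² ≤ C ρ` for all `ρ`,
so `c = 0`. [folklore] -/
theorem mustSqueeze_const_eq_zero_of_morrey {C : ℝ} (hC : 0 ≤ C) {c : ℝ³}
    (h : ∀ ρ : ℝ, 0 < ρ → ∫ _y in Metric.ball (0 : ℝ³) ρ, ‖c‖ ^ 2 ≤ C * ρ) : c = 0 := by
  by_contra hc
  have hcpos : 0 < ‖c‖ ^ 2 := by positivity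
  set k : ℝ := Real.pi * 4 / 3 * ‖c‖ ^ 2 with hk
  have hkpos : 0 < k := by positivity
  set ρ : ℝ := C / k + 1 with hρdef
  have hρ1 : 1 ≤ ρ := le_add_of_nonneg_left (div_nonneg hC hkpos.le)
  have hρ : 0 < ρ := lt_of_lt_of_le one_pos hρ1
  have key := h ρ hρ
  rw [setIntegral_const, smul_eq_mul, mustSqueeze_volume_real_ball 0 hρ.le] at key
  -- key : ρ ^ 3 * (π * 4 / 3) * ‖c‖ ^ 2 ≤ C * ρ
  have key' : ρ ^ 2 * k ≤ C := by
    have h3 : ρ * (ρ ^ 2 * k) ≤ ρ * C := by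
      calc ρ * (ρ ^ 2 * k) = ρ ^ 3 * (Real.pi * 4 / 3) * ‖c‖ ^ 2 := by rw [hk]; ring
        _ ≤ C * ρ := key
        _ = ρ * C := mul_comm _ _
    exact le_of_mul_le_mul_left h3 hρ
  have hlt : C < ρ * k := by
    have : C / k < ρ := by rw [hρdef]; exact lt_add_one _
    exact (div_lt_iff₀ hkpos).1 this
  have hle : ρ * k ≤ ρ ^ 2 * k := by
    refine mul_le_mul_of_nonneg_right ?_ hkpos.le
    nlinarith
  linarith

/-- **stub_endgame** — if every ball gradient energy of `U = lerayOrbit u` vanishes then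
`∇U ≡ 0` (continuous nonnegative integrand), each slice `U(s, ·)` is constant, the Morrey bound
`∫_{B_ρ}|U(s)|² ≤ Cρ` for all `ρ` forces the constant to be `0`, and `u ≡ 0` on `t < 0`
(`eq_lerayOrbit_of_neg`). -/
theorem stub_endgame : ∀ (C : ℝ) (u : ℝ → ℝ³ → ℝ³), IsTypeIAncientMild C u →
    (∀ (s : ℝ) (y₀ : ℝ³) (ρ : ℝ), 0 < ρ →
      ∫ y in Metric.ball y₀ ρ, ‖lerayOrbit u s y‖ ^ 2 ≤ C * ρ) →
    (∀ (ρ s : ℝ), 0 < ρ →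
      ∫ y in Metric.ball (0 : ℝ³) ρ, frobeniusNormSq (fderiv ℝ (lerayOrbit u s) y) = 0) →
    ∀ t < 0, ∀ x, u t x = 0 := by
  intro C u hK hMorrey hE t ht x
  -- every slice of the orbit vanishes identically
  have hU : ∀ (s : ℝ) (y : ℝ³), lerayOrbit u s y = 0 := by
    intro s
    -- `∇U(s) ≡ 0`
    have hgrad : ∀ y, fderiv ℝ (lerayOrbit u s) y = 0 :=
      mustSqueeze_fderiv_lerayOrbit_eq_zero hK (fun ρ hρ => hE ρ s hρ)
    -- `U(s)` is constant
    have hconst : ∀ y, lerayOrbit u s y = lerayOrbit u s 0 := fun y =>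
      is_const_of_fderiv_eq_zero
        ((mustSqueeze_contDiff_lerayOrbit_slice hK s (n := 1)).differentiable one_ne_zero) hgrad y 0
    -- the constant is zero
    have hc : lerayOrbit u s 0 = 0 := by
      refine mustSqueeze_const_eq_zero_of_morrey hK.nonneg fun ρ hρ => ?_
      have heq : ∫ y in Metric.ball (0 : ℝ³) ρ, ‖lerayOrbit u s y‖ ^ 2 =
          ∫ _y in Metric.ball (0 : ℝ³) ρ, ‖lerayOrbit u s 0‖ ^ 2 :=
        setIntegral_congr_fun measurableSet_ball fun y _ => by rw [hconst y]
      rw [← heq]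
      exact hMorrey s 0 ρ hρ
    intro y
    rw [hconst y, hc]
  -- back to physical variables
  rw [eq_lerayOrbit_of_neg u ht x, hU, smul_zero]

end Summit.NavierStokesRegularity.NavierStokesRegularity.Theorems

end
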